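import Summits.BirchSwinnertonDyer.BirchSwinnertonDyer.Theorems.GenusKolyvaginAtTwoPowDvdShaCardAtTwoRTNonPhantomHabitat
import Literature.NumberTheory.EllipticCurves.AnticyclotomicHeegnerPlacesDecompositionProofs
import HarnessLib

/-!
# Route `GenusKolyvaginAtTwo`, crux L_T `PowDvdShaCardAtTwoRT` (stmt-BirchSwinnertonDyer-23242), LINE 18 stub L, bottom rung:
# the NON-PHANTOM lemma (VII) — the LEAD's displayed hypothesis (NPh) of `false_of_bottomRung_engine_cheb`, DISCHARGED on
# the sub-habitat «some odd prime of multiplicative reduction»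

Seat `bsd-line-gk2-p3` g22 (PROVER 3/3, cell `bsd-f1-sign2`), `--supports stmt-BirchSwinnertonDyer-23242` (helper).
THEOREMS ONLY (no definition, no named fact, no `sorry`). BSD is not proved by any of this; neither is the crux.

LEAD gk2-p1 g17 (`…RTBottomRungEngineCheb.lean` p708250, `…RTNonPhantomHres.lean` p708349, memo
`Cruxes/PowDvdShaCardAtTwoRT/Lines/plus-descent-lead-g17.md`) reduced EVERY separation hypothesis `hres` that LINE 18 feeds to
Q5R / to the pair Čebotarev to ONE displayed hypothesis per level,

  (NPh)  `∀ z : H¹(K, E_K[4]), (∀ ρ ∈ Γ_{K(E[4])}, [z, ρ] = 0) → (∀ w, z ∈ selmerLocalKer (E_K) K_w 4) → z = 0`,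

and assigned its discharge on «∃ odd `p ∥ N`» to this seat (STATUS 07:52Z).  Here it is, VERBATIM in the displayed shape
(level `((2 ^ 2 : ℕ) : ℤ)`), from files (V)/(VI) — which need the Kummer condition at ONE place only:

* `eq_zero_baseChange_of_phantom_of_mem_selmerLocalKer` — single-class form at one place `w ∣ v`, `v ∤ 2` multiplicative;
* `nonPhantom_baseChange_of_hasMultiplicativeReductionAt` — (NPh) given a place `v ∤ 2` of ℚ of multiplicative reduction and
  `w ∣ v` with `e(w|v) = 1`;
* `nonPhantom_baseChange_of_heegner` — (NPh) in the route's frame: `K` Heegner for `N ≠ 0`, `w` a prime of `K` with `N ∈ w`,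
  `2 ∉ w`, and `E` multiplicative at the prime `w ∩ ℤ` (then `e(w|p) = 1` by the Heegner hypothesis,
  `ramificationIdx_eq_one_and_inertiaDeg_eq_one_of_natCast_mem_of_satisfiesHeegnerHypothesis`).

Frame hypotheses as in the crux: `Odd W.tamagawaProduct`, `ρ_{E,2ⁿ}` onto for all `n ≥ 1`, `K` imaginary quadratic with `d_K`
odd, `d_K·(−|Δ|)` and `d_K·(−2|Δ|)` non-squares.  References: [LawsonWuthrich2016] §7.1, §8; [GrossLMS1991] §1, Prop. 9.1.
-/

-- `Summit.<P>.<Sub>` repeats `BirchSwinnertonDyer` by the tree's layout convention (D-0017)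
set_option linter.dupNamespace false
set_option autoImplicit false

noncomputable section

open scoped Classical
open NumberField IsDedekindDomain Field

namespace Summit.BirchSwinnertonDyer.BirchSwinnertonDyer.Theorems.GenusExact.NonPhantom

open WeierstrassCurve Literature.NumberTheory.EllipticCurves Literature.NumberTheory.GaloisRepresentations

variable (W : WeierstrassCurve ℚ) [W.IsElliptic] {K : Type} [Field K] [NumberField K]

/-- **A phantom class that is Kummer at one odd multiplicative place is zero** (single-class form of file (VI)'s
`hres_baseChange_of_hasMultiplicativeReductionAt`, obtained from it with `y = 0`, `a = 1`, `b = 0`).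
[cite: LawsonWuthrich2016, §7.1 and §8] -/
theorem eq_zero_baseChange_of_phantom_of_mem_selmerLocalKer
    (hT : Odd W.tamagawaProduct) (hρ : ∀ n : ℕ, 0 < n → W.HasSurjectiveModNGaloisRep ((2 : ℤ) ^ n))
    (hK : IsImaginaryQuadratic K) (hdK : Odd (NumberField.discr K))
    (hns₁ : ¬ IsSquare ((NumberField.discr K : ℚ) * -|W.Δ|))
    (hns₂ : ¬ IsSquare ((NumberField.discr K : ℚ) * (-(2 * |W.Δ|))))
    {v : HeightOneSpectrum (𝓞 ℚ)} (h2v : ((2 : ℕ) : 𝓞 ℚ) ∉ v.asIdeal) (hmult : W.HasMultiplicativeReductionAt v)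
    (w : HeightOneSpectrum (𝓞 K)) [w.asIdeal.LiesOver v.asIdeal] (he : w.asIdeal.ramificationIdx (𝓞 ℚ) = 1)
    {n : ℤ} (hn : n = 4) {z : galH1Torsion (W.baseChange K) n}
    (hz : ∀ ρ ∈ torsionFixing (W.baseChange K) n, h1Eval (W.baseChange K) n z ρ = 0)
    (hzw : z ∈ selmerLocalKer (W.baseChange K) (w.adicCompletion K) n) : z = 0 := by
  have h := hres_baseChange_of_hasMultiplicativeReductionAt W hT hρ hK hdK hns₁ hns₂ h2v hmult w he hn hzw
    ((selmerLocalKer (W.baseChange K) (w.adicCompletion K) n).zero_mem) 1 0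
    (by rw [one_smul, zero_smul, add_zero]; exact hz)
  rwa [one_smul, zero_smul, add_zero] at h

/-- **(NPh) at a given odd multiplicative place.**  The LEAD's displayed hypothesis of `false_of_bottomRung_engine_cheb` /
`hres_of_nonPhantom_pow` at level `4 = 2²`, for `E_K = W.baseChange K`, from a place `v ∤ 2` of ℚ where `E` is multiplicative and
a prime `w ∣ v` of `K` with `e(w|v) = 1` (the Kummer hypothesis of (NPh) at ALL places is used at `w` only).
[cite: LawsonWuthrich2016, §7.1 and §8] -/
theorem nonPhantom_baseChange_of_hasMultiplicativeReductionAt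
    (hT : Odd W.tamagawaProduct) (hρ : ∀ n : ℕ, 0 < n → W.HasSurjectiveModNGaloisRep ((2 : ℤ) ^ n))
    (hK : IsImaginaryQuadratic K) (hdK : Odd (NumberField.discr K))
    (hns₁ : ¬ IsSquare ((NumberField.discr K : ℚ) * -|W.Δ|))
    (hns₂ : ¬ IsSquare ((NumberField.discr K : ℚ) * (-(2 * |W.Δ|))))
    {v : HeightOneSpectrum (𝓞 ℚ)} (h2v : ((2 : ℕ) : 𝓞 ℚ) ∉ v.asIdeal) (hmult : W.HasMultiplicativeReductionAt v)
    (w : HeightOneSpectrum (𝓞 K)) [w.asIdeal.LiesOver v.asIdeal] (he : w.asIdeal.ramificationIdx (𝓞 ℚ) = 1) :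
    ∀ z : galH1Torsion (W.baseChange K) ((2 ^ 2 : ℕ) : ℤ),
      (∀ ρ ∈ torsionFixing (W.baseChange K) ((2 ^ 2 : ℕ) : ℤ), h1Eval (W.baseChange K) ((2 ^ 2 : ℕ) : ℤ) z ρ = 0) →
      (∀ w' : HeightOneSpectrum (𝓞 K), z ∈ selmerLocalKer (W.baseChange K) (w'.adicCompletion K) ((2 ^ 2 : ℕ) : ℤ)) →
      z = 0 :=
  fun _ hz hzS ↦ eq_zero_baseChange_of_phantom_of_mem_selmerLocalKer W hT hρ hK hdK hns₁ hns₂ h2v hmult w he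
    (by norm_num) hz (hzS w)

/-- **(NPh) in the route's frame (Heegner form).**  `K` satisfies the Heegner hypothesis for `N ≠ 0`; `w` is a prime of `K`
containing `N` and not containing `2`; `E` has multiplicative reduction at the prime `w ∩ 𝓞_ℚ` below `w` (for `N` the conductor:
some odd `p ∥ N` and `w ∣ p`).  Then (NPh) holds for `E_K` at level `4`.  The ramification index `e(w|p) = 1` comes from the
Heegner hypothesis. [cite: GrossLMS1991, §1 (the Heegner hypothesis)] [cite: LawsonWuthrich2016, §7.1 and §8] -/
theorem nonPhantom_baseChange_of_heegner
    (hT : Odd W.tamagawaProduct) (hρ : ∀ n : ℕ, 0 < n → W.HasSurjectiveModNGaloisRep ((2 : ℤ) ^ n))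
    (hK : IsImaginaryQuadratic K) (hdK : Odd (NumberField.discr K))
    (hns₁ : ¬ IsSquare ((NumberField.discr K : ℚ) * -|W.Δ|))
    (hns₂ : ¬ IsSquare ((NumberField.discr K : ℚ) * (-(2 * |W.Δ|))))
    {N : ℕ} (hN : N ≠ 0) (hH : SatisfiesHeegnerHypothesis N K)
    (w : HeightOneSpectrum (𝓞 K)) (hNw : ((N : ℕ) : 𝓞 K) ∈ w.asIdeal) (h2w : ((2 : ℕ) : 𝓞 K) ∉ w.asIdeal)
    (hmult : W.HasMultiplicativeReductionAt (w.under (𝓞 ℚ))) :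
    ∀ z : galH1Torsion (W.baseChange K) ((2 ^ 2 : ℕ) : ℤ),
      (∀ ρ ∈ torsionFixing (W.baseChange K) ((2 ^ 2 : ℕ) : ℤ), h1Eval (W.baseChange K) ((2 ^ 2 : ℕ) : ℤ) z ρ = 0) →
      (∀ w' : HeightOneSpectrum (𝓞 K), z ∈ selmerLocalKer (W.baseChange K) (w'.adicCompletion K) ((2 ^ 2 : ℕ) : ℤ)) →
      z = 0 := by
  haveI : w.asIdeal.LiesOver (w.under (𝓞 ℚ)).asIdeal := ⟨rfl⟩
  have he : w.asIdeal.ramificationIdx (𝓞 ℚ) = 1 :=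
    (ramificationIdx_eq_one_and_inertiaDeg_eq_one_of_natCast_mem_of_satisfiesHeegnerHypothesis hK.1 hH hN w hNw).1
  have h2v : ((2 : ℕ) : 𝓞 ℚ) ∉ (w.under (𝓞 ℚ)).asIdeal := fun h ↦ h2w (by
    rw [HeightOneSpectrum.under_asIdeal, Ideal.under_def, Ideal.mem_comap, map_natCast] at h
    exact h)
  exact nonPhantom_baseChange_of_hasMultiplicativeReductionAt W hT hρ hK hdK hns₁ hns₂ h2v hmult w he

end Summit.BirchSwinnertonDyer.BirchSwinnertonDyer.Theorems.GenusExact.NonPhantom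

end
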